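import Summits.ResolutionOfSingularities.ResolutionOfSingularities.Theorems.HilbertSamuelEliminationCampaignW42TertiaryReduction
import Literature.AlgebraicGeometry.Resolution.SigmaMaxEliminationInDim
import Literature.AlgebraicGeometry.Resolution.PermissibleBlowupHilbertSamuel
import Literature.AlgebraicGeometry.Resolution.HilbertSamuelSemicontinuitySharp
import Literature.AlgebraicGeometry.Resolution.HilbertSamuelGenericConstancyExcellent
import Literature.AlgebraicGeometry.Resolution.QuasiExcellentSchemes
import Literature.AlgebraicGeometry.Resolution.NormalCrossingsStrictification
import Mathlib.AlgebraicGeometry.Morphisms.Proper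
import Mathlib.AlgebraicGeometry.Noetherian
import Mathlib.Topology.NoetherianSpace
import Mathlib.Topology.Separation.Basic
import HarnessLib

/-!
# [OURS · L1 W4.2] Good states of the canonical sequence `S(X, ν)` — bookkeeping for the compactness step
# (informal crux `TertiaryTermination`, stmt-ResolutionOfSingularities-17846; `--supports stmt-…-17846`)

OURS (slot W4.2, prover seat res-L1-s42-pv-2); NOT statements of H. Hironaka's manuscript; AI review is weaker than
expert review. First half of the compactness (König) step «an infinite `S(X, ν)` at an isolated origin carries an
infinite chain of closed near points» (completed in `…CampaignW42TertiaryCompactness.lean`): the data carried along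
the construction and its propagation. Ingredients, all PROVED in the tree / Mathlib: Bennett–Hironaka–Singh
`H^N_{X′}(x′) ≤ H^N_X(π x′)` for permissible blow-ups of excellent schemes (`IsBlowup.hsFun_le_of_isPermissible`),
upper semicontinuity of `H^N` on schemes of finite type over a field (`Scheme.hsFun_le_hsFun_of_specializes_over_field`,
`Scheme.isClosed_hsStratumGE_of_isExcellent`, Stacks 07QW), blow-ups proper and dimension-non-increasing
(`IsBlowup.isProper`, `IsBlowup.topologicalKrullDim_le_of_isLocallyNoetherian`).

PROVED here:
* `isClosed_hsStratumGE_over_field` — `W(≥ μ)` is closed for `W` of finite type over a field with `dim W ≤ N`.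
* `StateGood k R N ν W L P` — the data at a state `(W, L, P)` of `S(X, ν)`: finite type over the ground field `k`,
  `dim W ≤ N`, «`ν` is never exceeded» (`ν ≤ H(w) → H(w) = ν`, so `W(ν) = W(≥ ν)` is closed), and PERMISSIBILITY of the
  centres of all canonical runs from the state (CJS Lemma 5.34 (3) / Thm. 3.3 in the source's setting; a hypothesis at
  the origin); `StateGood.next` — propagation along canonical steps (`H^N` does not increase: `StateGood.hsFun_le`);
  `exists_stateGood_top_of_run` — hence along canonical runs.
* `exists_eq_cons_of_run` (functional oracle: a run of positive length starts with THE canonical step),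
  `exists_run_pred_of_run_succ` («LAST step» bookkeeping on the `cons`-structured `CentreSeq`: a stratum point at depth
  `m + 1` lies over one at depth `m`), `hsStratum_top_nonempty_of_runs` (the top stratum of a run is non-empty while
  longer runs exist), `hsFun_comp_le_of_run` (`H^N` does not increase along a run from a good state).

## References

* V. Cossart, U. Jannsen, S. Saito, LNM 2270 (2020), Thm. 2.33, Lemma 2.36, Thm. 3.10 (1), Cor. 3.12, Lemma 5.34 (3),
  Rem. 6.29 (1). [CossartJannsenSaito2020]
-/

noncomputable section

set_option linter.dupNamespace false -- mandated namespace of this single-conjunct summit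

open CategoryTheory AlgebraicGeometry TopologicalSpace Topology

namespace Summit.ResolutionOfSingularities.ResolutionOfSingularities.Theorems

namespace CampaignW42

open Literature.AlgebraicGeometry.Resolution Literature.RingTheory.HilbertSamuel

universe u

variable {p : ℕ} {R : ∀ S : Scheme.{u}, CentreSeq S → Prop} {N : ℕ} {ν : ℕ → ℕ}
variable {k : Type u} [Field k]

/-! ## Generalities: `ψ ≤ dim`, closed `ν`-strata over a field -/

/-- `ψ_W(w) ≤ N` once `dim W ≤ N`. [cite: CossartJannsenSaito2020, Def. 2.28] -/
theorem hsPsi_le_of_dim_le' {W : Scheme.{u}} [IsLocallyNoetherian W]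
    (hdim : topologicalKrullDim W ≤ (N : WithBot ℕ∞)) (w : W) : Scheme.hsPsi W w ≤ N := by
  have h1 : (Scheme.hsPsi W w : WithBot ℕ∞) ≤ ringKrullDim (W.presheaf.stalk w) :=
    minimalPrimesCodim_le_ringKrullDim (W.presheaf.stalk w)
  have h2 := (h1.trans (ringKrullDim_stalk_le_topologicalKrullDim W w)).trans hdim
  exact_mod_cast h2

/-- **`W(≥ ν)` is closed** for `W` of finite type over a field with `dim W ≤ N` (CJS Thm. 2.33 (3) from the sharp
Thm. 2.33 (1) over a field and excellence, Stacks 07QW). [cite: CossartJannsenSaito2020, Thm. 2.33 (3)] -/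
theorem isClosed_hsStratumGE_over_field {W : Scheme.{u}} (f : W ⟶ Spec (.of k)) [LocallyOfFiniteType f]
    [QuasiCompact f] (hdim : topologicalKrullDim W ≤ (N : WithBot ℕ∞)) (μ : ℕ → ℕ) :
    IsClosed (Scheme.hsStratumGE W N μ) := by
  haveI : IsLocallyNoetherian W := LocallyOfFiniteType.isLocallyNoetherian f
  haveI : IsNoetherian W := Scheme.isNoetherian_of_finiteType_over_field f
  exact Scheme.isClosed_hsStratumGE_of_isExcellent
    (Scheme.isExcellent_of_locallyOfFiniteType Stacks07QW_field_holds f) N (hsPsi_le_of_dim_le' hdim)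
    (fun _ _ h => Scheme.hsFun_le_hsFun_of_specializes_over_field f N h) μ

/-- If `ν` is never exceeded on `W` then `W(ν) = W(≥ ν)`. [folklore] -/
theorem hsStratum_eq_hsStratumGE_of_supMax {W : Scheme.{u}}
    (hsup : ∀ w : W, ν ≤ Scheme.hsFun W N w → Scheme.hsFun W N w = ν) :
    Scheme.hsStratum W N ν = Scheme.hsStratumGE W N ν := by
  ext w
  exact ⟨fun h => le_of_eq (Scheme.mem_hsStratum_iff.mp h).symm, fun h => hsup w h⟩

/-! ## Good states of `S(X, ν)` -/

/-- THE DATA CARRIED ALONG THE CONSTRUCTION at a state `(W, L, P)` of `S(X, ν)`: `W` of finite type over the ground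
field `k`, `dim W ≤ N`, `ν` never exceeded by `H^N_W` (so `W(ν) = W(≥ ν)` is closed), and every canonical run from the
state has permissible centres (CJS Lemma 5.34 (3) in the source's setting; the hypothesis of the theorems below at the
origin). OURS bookkeeping; NOT a statement of the manuscript. [folklore] -/
structure StateGood (k : Type u) [Field k] (R : ∀ S : Scheme.{u}, CentreSeq S → Prop) (N : ℕ) (ν : ℕ → ℕ)
    (W : Scheme.{u}) (L : Labelling W) (P : Option (Pending W)) : Prop where
  /-- `W` is of finite type over `k` -/
  overField : ∃ f : W ⟶ Spec (.of k), LocallyOfFiniteType f ∧ QuasiCompact f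
  /-- the level bounds the dimension -/
  dim_le : topologicalKrullDim W ≤ (N : WithBot ℕ∞)
  /-- `ν` is never exceeded -/
  supMax : ∀ w : W, ν ≤ Scheme.hsFun W N w → Scheme.hsFun W N w = ν
  /-- the centres of all canonical runs from the state are permissible -/
  permRuns : ∀ t : CentreSeq W, IsCanonicalRunFrom R N ν L P t → t.AllPermissible

namespace StateGood

variable {W : Scheme.{u}} {L : Labelling W} {P : Option (Pending W)}

/-- A good state is locally Noetherian. [folklore] -/
theorem isLocallyNoetherian (h : StateGood k R N ν W L P) : IsLocallyNoetherian W := by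
  obtain ⟨f, hf, -⟩ := h.overField
  exact LocallyOfFiniteType.isLocallyNoetherian f

/-- A good state is Noetherian. [folklore] -/
theorem isNoetherian (h : StateGood k R N ν W L P) : IsNoetherian W := by
  obtain ⟨f, hf, hq⟩ := h.overField
  exact Scheme.isNoetherian_of_finiteType_over_field f

/-- A good state is excellent. [cite: StacksProject, Tag 07QW] -/
theorem isExcellent (h : StateGood k R N ν W L P) : Scheme.IsExcellent W := by
  obtain ⟨f, hf, -⟩ := h.overField
  exact Scheme.isExcellent_of_locallyOfFiniteType Stacks07QW_field_holds f

/-- At a good state the `ν`-stratum is closed. [cite: CossartJannsenSaito2020, Lemma 2.36 (a)] -/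
theorem isClosed_hsStratum (h : StateGood k R N ν W L P) : IsClosed (Scheme.hsStratum W N ν) := by
  obtain ⟨f, hf, hq⟩ := h.overField
  rw [hsStratum_eq_hsStratumGE_of_supMax h.supMax]
  exact isClosed_hsStratumGE_over_field f h.dim_le ν

/-- The centre of a canonical step from a good state is permissible. [folklore] -/
theorem isPermissible (h : StateGood k R N ν W L P) {C : W.IdealSheafData} {P' : Option (Pending (blowup C))}
    (hst : IsCanonicalStep R N ν L P C P') : IdealSheafData.IsPermissible C :=
  ((CentreSeq.allPermissible_cons C (CentreSeq.nil _)).mp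
    (h.permRuns (CentreSeq.cons C (CentreSeq.nil _)) ⟨P', hst, trivial⟩)).1

/-- `H^N` does not increase along a canonical step from a good state (Bennett–Hironaka–Singh, CJS Thm. 3.10 (1), for
the permissible centre of the step). [cite: CossartJannsenSaito2020, Thm. 3.10 (1)] -/
theorem hsFun_le (h : StateGood k R N ν W L P) {C : W.IdealSheafData} {P' : Option (Pending (blowup C))}
    (hst : IsCanonicalStep R N ν L P C P') (z : ↥(blowup C)) :
    Scheme.hsFun (blowup C) N z ≤ Scheme.hsFun W N ((blowup.π C).base z) := by
  haveI := h.isLocallyNoetherian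
  exact (blowup.isBlowup C).hsFun_le_of_isPermissible h.isExcellent (h.isPermissible hst) N z

/-- **Good states propagate along canonical steps.** [folklore] -/
theorem next (h : StateGood k R N ν W L P) {C : W.IdealSheafData} {P' : Option (Pending (blowup C))}
    (hst : IsCanonicalStep R N ν L P C P') :
    StateGood k R N ν (blowup C) (L.next (Scheme.hsStratum W N ν) C) P' := by
  haveI := h.isLocallyNoetherian
  haveI : IsProper (blowup.π C) := (blowup.isBlowup C).isProper
  obtain ⟨f, hf, hq⟩ := h.overField
  refine ⟨⟨blowup.π C ≫ f, inferInstance, inferInstance⟩,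
    (blowup.isBlowup C).topologicalKrullDim_le_of_isLocallyNoetherian h.dim_le, fun z hz => ?_, fun t ht => ?_⟩
  · have hle := h.hsFun_le hst z
    have heq := h.supMax _ (hz.trans hle)
    exact le_antisymm (heq ▸ hle) hz
  · exact ((CentreSeq.allPermissible_cons C t).mp (h.permRuns (CentreSeq.cons C t) ⟨P', hst, ht⟩)).2

/-- A stratum point upstairs of a canonical step from a good state lies over a stratum point. [folklore] -/
theorem base_mem_hsStratum (h : StateGood k R N ν W L P) {C : W.IdealSheafData}
    {P' : Option (Pending (blowup C))} (hst : IsCanonicalStep R N ν L P C P') {z : ↥(blowup C)}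
    (hz : z ∈ Scheme.hsStratum (blowup C) N ν) : (blowup.π C).base z ∈ Scheme.hsStratum W N ν :=
  h.supMax _ ((Scheme.mem_hsStratum_iff.mp hz).symm.le.trans (h.hsFun_le hst z))

end StateGood

/-! ## Runs from a state: first-step decomposition (functional oracle) and last-step bookkeeping -/

/-- For a functional oracle, a run of positive length from `(L, P)` begins with THE canonical step from `(L, P)`.
[folklore] -/
theorem exists_eq_cons_of_run (hRf : OracleFunctional R) {W : Scheme.{u}} {L : Labelling W}
    {P : Option (Pending W)} {C : W.IdealSheafData} {P' : Option (Pending (blowup C))}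
    (hst : IsCanonicalStep R N ν L P C P') {t : CentreSeq W} (ht : IsCanonicalRunFrom R N ν L P t) {m : ℕ}
    (hlen : t.length = m + 1) :
    ∃ rest : CentreSeq (blowup C), t = CentreSeq.cons C rest ∧
      IsCanonicalRunFrom R N ν (L.next (Scheme.hsStratum W N ν) C) P' rest ∧ rest.length = m := by
  cases t with
  | nil _ => simp at hlen
  | cons C₁ rest =>
    obtain ⟨P₁, hst₁, hrest⟩ := ht
    obtain rfl : C₁ = C := hst₁.centre_unique hRf hst
    obtain rfl : P₁ = P' := hst₁.pending_unique hRf hst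
    exact ⟨rest, rfl, hrest, by simpa using hlen⟩

/-- **LAST-STEP BOOKKEEPING**: along canonical runs from a good state, every stratum point at depth `m + 1` lies over
a stratum point at depth `m` (with the same image at depth `0`). [folklore] -/
theorem exists_run_pred_of_run_succ (m : ℕ) :
    ∀ {W : Scheme.{u}} {L : Labelling W} {P : Option (Pending W)}, StateGood k R N ν W L P →
      ∀ (t' : CentreSeq W), IsCanonicalRunFrom R N ν L P t' → t'.length = m + 1 →
      ∀ z' : t'.top, z' ∈ Scheme.hsStratum t'.top N ν →
        ∃ (t : CentreSeq W), IsCanonicalRunFrom R N ν L P t ∧ t.length = m ∧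
          ∃ z : t.top, z ∈ Scheme.hsStratum t.top N ν ∧ t.comp.base z = t'.comp.base z' := by
  induction m with
  | zero =>
    intro W L P hgood t' ht' hlen z' hz'
    cases t' with
    | nil _ => simp at hlen
    | cons C rest =>
      obtain ⟨P', hst, hrest⟩ := ht'
      cases rest with
      | cons _ _ => simp at hlen
      | nil _ =>
        exact ⟨CentreSeq.nil W, trivial, rfl, (blowup.π C).base z', hgood.base_mem_hsStratum hst hz', rfl⟩
  | succ m ih =>
    intro W L P hgood t' ht' hlen z' hz'
    cases t' with
    | nil _ => simp at hlen
    | cons C r' =>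
      obtain ⟨P', hst, hr'⟩ := ht'
      have hlen' : r'.length = m + 1 := by simpa using hlen
      obtain ⟨r, hr, hrlen, z, hz, hzeq⟩ := ih (hgood.next hst) r' hr' hlen' z' hz'
      refine ⟨CentreSeq.cons C r, ⟨P', hst, hr⟩, by simp [hrlen], z, hz, ?_⟩
      show (blowup.π C).base (r.comp.base z) = (blowup.π C).base (r'.comp.base z')
      rw [hzeq]

/-- Along a canonical run from a good state the top carries a good state. [folklore] -/
theorem exists_stateGood_top_of_run (m : ℕ) :
    ∀ {W : Scheme.{u}} {L : Labelling W} {P : Option (Pending W)}, StateGood k R N ν W L P →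
      ∀ t : CentreSeq W, IsCanonicalRunFrom R N ν L P t → t.length = m →
        ∃ (L' : Labelling t.top) (P' : Option (Pending t.top)), StateGood k R N ν t.top L' P' := by
  induction m with
  | zero =>
    intro W L P hg t ht hlen
    cases t with
    | nil _ => exact ⟨L, P, hg⟩
    | cons _ _ => simp at hlen
  | succ m ih =>
    intro W L P hg t ht hlen
    cases t with
    | nil _ => simp at hlen
    | cons C rest =>
      obtain ⟨Q, hst, hrest⟩ := ht
      exact ih (hg.next hst) rest hrest (by simpa using hlen)

/-! ## Along runs: non-empty strata, `H^N` monotone -/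

/-- Stratum points at depth `m` from a state with runs of every length: the top stratum of a run is non-empty
(the next canonical step exists only while the stratum is non-empty). [cite: CossartJannsenSaito2020, Rem. 6.29 (1)] -/
theorem hsStratum_top_nonempty_of_runs (hRf : OracleFunctional R) (m : ℕ) :
    ∀ {W : Scheme.{u}} {L : Labelling W} {P : Option (Pending W)} (t : CentreSeq W),
      IsCanonicalRunFrom R N ν L P t → t.length = m →
      (∃ t' : CentreSeq W, IsCanonicalRunFrom R N ν L P t' ∧ t'.length = m + 1) →
        (Scheme.hsStratum t.top N ν).Nonempty := by
  induction m with
  | zero =>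
    intro W L P t ht hlen ⟨t', ht', hlen'⟩
    cases t with
    | cons _ _ => simp at hlen
    | nil _ =>
      cases t' with
      | nil _ => simp at hlen'
      | cons C rest =>
        obtain ⟨P', hst, -⟩ := ht'
        exact hst.hsStratum_nonempty
  | succ m ih =>
    intro W L P t ht hlen ⟨t', ht', hlen'⟩
    cases t with
    | nil _ => simp at hlen
    | cons C rest =>
      obtain ⟨P', hst, hrest⟩ := ht
      obtain ⟨rest', rfl, hrest', hrlen'⟩ := exists_eq_cons_of_run hRf hst ht' hlen'
      exact ih rest hrest (by simpa using hlen) ⟨rest', hrest', hrlen'⟩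

/-- `H^N` does not increase along a canonical run from a good state. [cite: CossartJannsenSaito2020, Thm. 3.10 (1)] -/
theorem hsFun_comp_le_of_run :
    ∀ {W : Scheme.{u}} {L : Labelling W} {P : Option (Pending W)}, StateGood k R N ν W L P →
      ∀ (t : CentreSeq W), IsCanonicalRunFrom R N ν L P t →
        ∀ z : t.top, Scheme.hsFun t.top N z ≤ Scheme.hsFun W N (t.comp.base z)
  | W, L, P, hg, CentreSeq.nil _, _, z => le_rfl
  | W, L, P, hg, CentreSeq.cons C rest, ht, z => by
    obtain ⟨P', hst, hrest⟩ := ht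
    have h1 := hsFun_comp_le_of_run (hg.next hst) rest hrest z
    have h2 := hg.hsFun_le hst (rest.comp.base z)
    exact h1.trans h2

end CampaignW42

end Summit.ResolutionOfSingularities.ResolutionOfSingularities.Theorems

end
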